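import Mathlib
import HarnessLib
import Summits.ValiantsHypothesis.ValiantsHypothesis.Theorems.KPlusLogSqLawWeakLiftingTowerGraftWronskianKFourTurning

/-!
# Tower graft line — CONJECTURE W AT `K = 4`: MONOTONE LAPS OF A QUOTIENT AND LEVEL CROSSINGS

Helper file for LINE (B) `Cruxes/WeakLifting/Lines/tower_graft.lean` (crux `WeakLifting` = stmt-ValiantsHypothesis-19561): the third
ANALYTIC brick of the lap calculus of hand g11's memo (`evidence-g11-conjectureW-K4-levels.md` on the item), after `…KFourRoots` (poles)
and `…KFourTurning` (simple zeros of `W` are turning points).  NO stub is claimed.  For real polynomials `F, G`: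

* `strictMonoOn_div_of_wronskian_pos` / `strictAntiOn_div_of_wronskian_neg` — on a closed interval free of zeros of `F` on which
  `W(F,G)` is positive (negative) in the interior, the quotient `G/F` is strictly monotone: a LAP;
* `exists_level_root_of_between` — on such an interval every level `c` strictly between the end values of `G/F` is taken in the
  interior, i.e. the member `G − c·F` has a root there (IVT);
* `card_le_countP_posRoots` — `k` distinct positive roots of a nonzero polynomial give `countP (0 < ·) roots ≥ k`: the bridge from
  «`c` is crossed on `k` laps» to the Descartes tables of `…KFourLevels` / `…KFourQuotients` / `…KFourLevelTables`;
* `countP_posRoots_fewnomial_four_le_three` — the trivial top row of those tables (`≤ 3` for every `4`-nomial with a nonzero coefficient).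

HONEST FRAMING: Conjecture W at `K = 4` remains OPEN (memo §3: the single-quotient lap calculus does not exclude the fifth zero);
nothing on S4/S4f/S5/S5ᴸ, TowerB, `WeakLifting`, Conjecture B, `MatrixDescartes` (18050), `VP ≠ VNP`.  Def-free.  Seat: prover
leafhand-val-kpluslogsqlaw-1 g11, `--supports stmt-ValiantsHypothesis-19561 --as helper`.  [folklore: monotonicity from the sign of the
derivative, IVT, Descartes (Mathlib)]
-/

-- `Summit.ValiantsHypothesis.ValiantsHypothesis.…` repeats a component by the D-0017 layout
-- (single-conjunct summit), which the `dupNamespace` linter flags; the name is mandated.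
set_option linter.dupNamespace false
set_option autoImplicit false

namespace Summit.ValiantsHypothesis.ValiantsHypothesis.Theorems.KPlusLogSqLaw.TowerGraft

open Polynomial Finset Filter Topology
open scoped BigOperators Polynomial
open Summit.ValiantsHypothesis.ValiantsHypothesis.Theorems.LacunarySymmetroidMatrixDescartes.Census
  (signVariations_rsum_le_changes)

namespace WronskianDevelopable

/-! ## §1 Laps -/

/-- the quotient is continuous on a set free of zeros of the denominator. [folklore] -/
theorem continuousOn_div_eval (F G : ℝ[X]) {s : Set ℝ} (hF : ∀ t ∈ s, F.eval t ≠ 0) :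
    ContinuousOn (fun t => G.eval t / F.eval t) s :=
  G.continuous.continuousOn.div F.continuous.continuousOn hF

/-- ★ **an ascending lap**: if `F ≠ 0` on `[a,b]` and `W(F,G) > 0` on `(a,b)` then `G/F` is strictly increasing on `[a,b]`. [folklore] -/
theorem strictMonoOn_div_of_wronskian_pos (F G : ℝ[X]) {a b : ℝ} (hF : ∀ t ∈ Set.Icc a b, F.eval t ≠ 0)
    (hW : ∀ t ∈ Set.Ioo a b, 0 < (wronskian F G).eval t) :
    StrictMonoOn (fun t => G.eval t / F.eval t) (Set.Icc a b) := by
  refine strictMonoOn_of_deriv_pos (convex_Icc a b) (continuousOn_div_eval F G hF) ?_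
  intro t ht
  rw [interior_Icc] at ht
  have hFt : F.eval t ≠ 0 := hF t (Set.Ioo_subset_Icc_self ht)
  rw [deriv_div_eval F G hFt]
  exact div_pos (hW t ht) (by positivity)

/-- ★ **a descending lap**: if `F ≠ 0` on `[a,b]` and `W(F,G) < 0` on `(a,b)` then `G/F` is strictly decreasing on `[a,b]`. [folklore] -/
theorem strictAntiOn_div_of_wronskian_neg (F G : ℝ[X]) {a b : ℝ} (hF : ∀ t ∈ Set.Icc a b, F.eval t ≠ 0)
    (hW : ∀ t ∈ Set.Ioo a b, (wronskian F G).eval t < 0) :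
    StrictAntiOn (fun t => G.eval t / F.eval t) (Set.Icc a b) := by
  refine strictAntiOn_of_deriv_neg (convex_Icc a b) (continuousOn_div_eval F G hF) ?_
  intro t ht
  rw [interior_Icc] at ht
  have hFt : F.eval t ≠ 0 := hF t (Set.Ioo_subset_Icc_self ht)
  rw [deriv_div_eval F G hFt]
  exact div_neg_of_neg_of_pos (hW t ht) (by positivity)

/-! ## §2 Level crossings -/

/-- a value of the quotient is a root of the corresponding level member: `(G/F)(x) = c`, `F(x) ≠ 0` ⇒ `(G − c·F)(x) = 0`. [folklore] -/
theorem eval_level_eq_zero_of_div_eq (F G : ℝ[X]) {x c : ℝ} (hF : F.eval x ≠ 0) (h : G.eval x / F.eval x = c) :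
    (G - C c * F).eval x = 0 := by
  rw [eval_sub, eval_mul, eval_C, ← h, div_mul_cancel₀ _ hF, sub_self]

/-- conversely a root of the level member off the zeros of `F` is a point of the level set. [folklore] -/
theorem div_eq_of_eval_level_eq_zero (F G : ℝ[X]) {x c : ℝ} (hF : F.eval x ≠ 0) (h : (G - C c * F).eval x = 0) :
    G.eval x / F.eval x = c := by
  rw [eval_sub, eval_mul, eval_C, sub_eq_zero] at h
  rw [h, mul_div_assoc, div_self hF, mul_one]

/-- ★ **every level strictly between the end values of a zero-free interval is crossed inside it** (IVT): there is `x ∈ (a,b)` with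
`(G − c·F)(x) = 0`. [folklore] -/
theorem exists_level_root_of_between (F G : ℝ[X]) {a b c : ℝ} (hab : a ≤ b) (hF : ∀ t ∈ Set.Icc a b, F.eval t ≠ 0)
    (hc : (G.eval a / F.eval a < c ∧ c < G.eval b / F.eval b) ∨ (G.eval b / F.eval b < c ∧ c < G.eval a / F.eval a)) :
    ∃ x ∈ Set.Ioo a b, (G - C c * F).eval x = 0 := by
  have hcont := continuousOn_div_eval F G hF
  rcases hc with ⟨h1, h2⟩ | ⟨h1, h2⟩
  · obtain ⟨x, hx, hval⟩ := intermediate_value_Ioo hab hcont ⟨h1, h2⟩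
    exact ⟨x, hx, eval_level_eq_zero_of_div_eq F G (hF x (Set.Ioo_subset_Icc_self hx)) hval⟩
  · obtain ⟨x, hx, hval⟩ := intermediate_value_Ioo' hab hcont ⟨h1, h2⟩
    exact ⟨x, hx, eval_level_eq_zero_of_div_eq F G (hF x (Set.Ioo_subset_Icc_self hx)) hval⟩

/-- ★ **counting bridge**: `k` distinct positive roots of a nonzero polynomial force `countP (0 < ·) roots ≥ k`. [folklore] -/
theorem card_le_countP_posRoots (f : ℝ[X]) (hf : f ≠ 0) (S : Finset ℝ) (hS : ∀ x ∈ S, 0 < x ∧ f.eval x = 0) :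
    S.card ≤ f.roots.countP (fun t => 0 < t) := by
  classical
  have hsub : S.val ≤ f.roots := by
    rw [Multiset.le_iff_subset S.nodup]
    intro x hx
    exact (mem_roots hf).mpr (hS x hx).2
  have hall : S.val.countP (fun t => 0 < t) = S.card := by
    rw [Multiset.countP_eq_card_filter, Multiset.filter_eq_self.mpr (fun x hx => (hS x hx).1)]
    rfl
  calc S.card = S.val.countP (fun t => 0 < t) := hall.symm
    _ ≤ f.roots.countP (fun t => 0 < t) := Multiset.countP_le_of_le _ hsub

/-- so: if a level member `G − c·F` has `k` distinct positive roots but Descartes allows fewer, contradiction — packaged as an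
inequality between a finset of level points of `G/F` and the multiplicity count. [folklore] -/
theorem card_levelSet_le_countP (F G : ℝ[X]) {c : ℝ} (hne : G - C c * F ≠ 0) (S : Finset ℝ)
    (hS : ∀ x ∈ S, 0 < x ∧ F.eval x ≠ 0 ∧ G.eval x / F.eval x = c) :
    S.card ≤ (G - C c * F).roots.countP (fun t => 0 < t) :=
  card_le_countP_posRoots _ hne S (fun x hx => ⟨(hS x hx).1, eval_level_eq_zero_of_div_eq F G (hS x hx).2.1 (hS x hx).2.2⟩)

/-! ## §3 The trivial top row of the level tables -/

/-- **every nonzero `4`-nomial on a strictly increasing support has at most `3` positive roots counted with multiplicity.** [folklore] -/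
theorem countP_posRoots_fewnomial_four_le_three (w : Fin 4 → ℝ) (d : Fin 4 → ℕ) (hd : StrictMono d) :
    (∑ l, C (w l) * (X : ℝ[X]) ^ d l).roots.countP (fun x => 0 < x) ≤ 3 := by
  refine (countP_posRoots_fewnomial_four_le_pattern w d hd (fun t => decide (0 ≤ w (if t = 0 then 0 else if t = 1 then 1
    else if t = 2 then 2 else 3))) ?_ ?_ ?_ ?_).trans ?_
  · exact ⟨fun h => by simpa using h, fun h => le_of_lt (by simpa using h)⟩
  · exact ⟨fun h => by simpa using h, fun h => le_of_lt (by simpa using h)⟩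
  · exact ⟨fun h => by simpa using h, fun h => le_of_lt (by simpa using h)⟩
  · exact ⟨fun h => by simpa using h, fun h => le_of_lt (by simpa using h)⟩
  · exact (Finset.sum_le_card_nsmul _ _ 1 (fun t _ => by split_ifs <;> simp)).trans (by simp)

end WronskianDevelopable

end Summit.ValiantsHypothesis.ValiantsHypothesis.Theorems.KPlusLogSqLaw.TowerGraft
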